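/-
Copyright (c) 2026 the pub-hodgecm-mathlib formalisation cell (harness21).  Prover seat hodgecm-mathlib-LH4-p13 (g8), req620 Track A «(D-RAM) FOUR-FRAME» squad, tier 0,
STAGE-1b (dealer LH4-plan (g13) WORD #91 (a) «LABEL = NORM CLASS OF THE SKEW COORDINATE, PER ★ SHAPE»; consumers F0P3a-p01 (g36) B2b-1 and this seat's B2b-2):
brick (L-lab-19b).  On the clean shell of a normalised HNF vertex the value set is `valueSetMod σ ϖ m (s • X₊)` for ONE EXPLICIT scalar `s` — `A∕t₊` (glued ∕ two-slot:
the SUM `A = D₀(α−1) + D₁σx(β−1)x`), `C∕t₊` at `b = 0`, or the dominating slot — read at precision `m` with ★ (L-lab-3)'s congruence rule.  2026-09-04.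
-/
import Summits.HodgeConjecture.HodgeConjecture.Theorems.F0P3cDyRamHNFExplicitTop      -- ★ (this seat, (L-lab-19a)): `explicit_top_of_clean_shell_latt_hnf`; brings ★ p860285, p860236, p860186, ★ `dualisable_strata`
import Summits.HodgeConjecture.HodgeConjecture.Theorems.F0P3cDyRamCleanShellOneClass   -- ★ p860136 (this seat, (L-lab-16)): `cross_self_expand`, `modelValue_eq_cross_self`, `v_cross_add_map_cross_le`
import HarnessLib

/-!
# Crux `H413`, line LH4 «(D-RAM) FOUR-FRAME», STAGE-1b — (L-lab-19b) «THE LABEL CLASS OF A CLEAN-SHELL STRATUM, BY NAME»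

Cell `hodgecm-mathlib` (D-0151), FLOOR 0, crux item H413 = `stmt-HodgeConjecture-24833`, route of record `HCCMUnconditional`; squad F0∕P3c∕LH4.  THEOREMS ONLY (no `def`, no
instance, no notation, no `sorry`, default heartbeats), ★-only imports, lane `--supports stmt-HodgeConjecture-24833`.

Letters: `S(w, w′) = D₀σ(w₀)(α−1)w′₀ + D₁σ(w₁)(β−1)w′₁`; `t₊ = (ϖ − σϖ)((ϖσϖ)^{(d − d%2)∕2})⁻¹` (★ `xPlus`' skew scalar); HNF letters `A = D₀(α−1) + D₁σx(β−1)x = S(v⁰,v⁰)`,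
`C = D₁σ(ϖ^b)(β−1)ϖ^b = S(v¹,v¹)`; `VAL_m(M) = {v | ∃ w ∈ M, |ϖ^{−m}(v − (D₀(α−1)N(w₀) + D₁(β−1)N(w₁)))| ≤ 1}`.
* §1 (generic, any lattice) `setOf_modelValue_eq_valueSetMod_smul_of_triple` — on an S-diagonal generating triple with `|S(y₂,y₂)| ≤ |ϖ^m|` (no top condition, no datum clause):
  `VAL_m(M) = valueSetMod σ ϖ m ((S(y₁,y₁)·t₊⁻¹) • X₊)`; `exists_fixed_unit_congr_of_clean` — on the clean shell, a value `S(w,w)` of valuation `|ϖ|^{d%2}` is `ϖ^m`-congruent to `e′·t₊` for a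
  `σ`-fixed UNIT `e′` (the `hee` of ★ (L-lab-3) `labelPlus_smul_xPlus_iff_exists_norm_of_congr`, so `LabelPlus ⟺ ∃ z, zσz = e′`).
* §2 (the HNF vertex, ★ (L-lab-19a)) `top_A_or_top_C_of_clean_shell_latt_hnf`; **`setOf_modelValue_latt_hnf_eq_smul_A`** (`|A| = |ϖ^ℓ|` ⇒ scalar `A∕t₊`);
  **`setOf_modelValue_latt_hnf_eq_smul_C`** (`b = 0`, `|C| = |ϖ^ℓ|` ⇒ scalar `C∕t₊`, with `v_D0_eq_one_of_top_C` from the strata core∕T₁); the dominated reads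
  `setOf_modelValue_latt_hnf_eq_smul_slot0` ∕ `_slot1` (★ `valueSetMod_smul_xPlus_congr`).

HONEST LABEL: count-neutral; these are the per-stratum label reads for the (β-BAL) Stage-B sums (B2b-1∕B2b-2), nothing summed here.  HC_CM remains proved only modulo the printed
citations (2 remaining named inputs: hLiu418 = `stmt-HodgeConjecture-24832`, h413 = `stmt-HodgeConjecture-24833`) until rung 0 closes.
-/

noncomputable section

namespace Summit.HodgeConjecture.HodgeConjecture.Cruxes.H413.F0P3cDyRamLabelClassOfStratum

open Literature.NumberTheory.Automorphic Literature.NumberTheory.Automorphic.HermitianLattice Literature.NumberTheory.Automorphic.UnitaryGroup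
open Literature.NumberTheory.Automorphic.UnitaryLatticeTree Literature.NumberTheory.Automorphic.UnitaryThreeFourFrame
open Literature.NumberTheory.LocalFields Literature.NumberTheory.LocalFields.WildQuadraticDatum
open Summit.HodgeConjecture.HodgeConjecture.Cruxes.H413.F0P3cDyRamFourFramePieces
open Summit.HodgeConjecture.HodgeConjecture.Cruxes.H413.F0P3cDyRamFourFrameCensusDefs
open Summit.HodgeConjecture.HodgeConjecture.Cruxes.H413.F0P3cDyRamDiagonalTorusDefs
open Summit.HodgeConjecture.HodgeConjecture.Cruxes.H413.F0P3cDyRamDiagonalStableLatticeHNF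
open Summit.HodgeConjecture.HodgeConjecture.Cruxes.H413.F0P3cDyRamDiagonalHNFDualFrameValues (dualFrame_values)
open Summit.HodgeConjecture.HodgeConjecture.Cruxes.H413.F0P3cDyRamDiagonalDualisableStrata (dualisable_strata)
open Summit.HodgeConjecture.HodgeConjecture.Cruxes.H413.F0P3cDyRamSmulXPlusLabel (valueSetMod_smul_xPlus)
open Summit.HodgeConjecture.HodgeConjecture.Cruxes.H413.F0P3cDyRamFrameEltOneSlotLabel (valueSetMod_smul_xPlus_congr)
open Summit.HodgeConjecture.HodgeConjecture.Cruxes.H413.F0P3cDyRamValueSetSkewLineCriterion (exists_skew_near_of_trace_deep)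
open Summit.HodgeConjecture.HodgeConjecture.Cruxes.H413.F0P3cDyRamLevelTokenHNF (latticeInLevel_iff_forall_smul_mulVec_mem latticeInLevel_diagonal_latt_hnf_iff)
open Summit.HodgeConjecture.HodgeConjecture.Cruxes.H413.F0P3cDyRamUniformizerPowerTube (v_pow_eq_exp_neg)
open Summit.HodgeConjecture.HodgeConjecture.Cruxes.H413.F0P3cDyRamCleanShellOneClass (cross_self_expand modelValue_eq_cross_self v_cross_add_map_cross_le)
open Summit.HodgeConjecture.HodgeConjecture.Cruxes.H413.F0P3cDyRamHNFCrossGram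
open Summit.HodgeConjecture.HodgeConjecture.Cruxes.H413.F0P3cDyRamHNFExplicitTop (explicit_top_of_clean_shell_latt_hnf)
open scoped Valued WithZero Matrix MatrixGroups
open WithZero

variable {K : Type} [Field K] [Valued K ℤᵐ⁰]

/-! ## §1  Generic: the value set on an S-diagonal generating triple is the class of the top value, explicitly -/

/-- **THE VALUE SET IS `valueSetMod (s₁∕t₊ • X₊)` ON THE NOSE.**  `M` a lattice on which `diag c` is integral, stable under `T = diag(α,β,1)` (`α, β ∈ E¹`, `c₀, c₁` `σ`-fixed, `σ` an
involution), with `X²·M ⊆ ϖ^{m_c}M`, `m ≤ m_c`; `y₁, y₂ ∈ M` and `y₃` on the third axis generating `M`, `S(y₁, y₂) = 0`, `|S(y₂, y₂)| ≤ |ϖ^m|`.  Then, with `s₁ = S(y₁, y₁)` and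
`t₊ = (ϖ − σϖ)((ϖσϖ)^{(d−d%2)∕2})⁻¹ ≠ 0`: `VAL_m(M) = valueSetMod σ ϖ m ((s₁·t₊⁻¹) • X₊)` — every value is `≡ N(a)·s₁ (mod ϖ^m)` (★ p860136 §1: the cross term `S(y₂,y₁)` is in `ϖ^{m_c}`).
No top condition and no skew approximation are needed for this form. [cite: Rogawski1990, §4.9 Prop. 4.9.1 (b) p. 55] [cite: Kottwitz1986BaseChangeUnits, §1 pp. 240–241] -/
theorem setOf_modelValue_eq_valueSetMod_smul_of_triple {σ : K →+* K} (hσ : ∀ x, σ (σ x) = x) (hvσ : ∀ a, Valued.v (σ a) = Valued.v a) {ϖ : K}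
    (hϖ : Valued.v ϖ = exp (-1 : ℤ)) (d : ℕ) (htp0 : (ϖ - σ ϖ) * ((ϖ * σ ϖ) ^ ((d - d % 2) / 2))⁻¹ ≠ 0)
    {c : Fin 3 → K} (hc₀ : σ (c 0) = c 0) (hc₁ : σ (c 1) = c 1) {α β : K} (hα : α * σ α = 1) (hβ : β * σ β = 1)
    {M : Submodule 𝒪[K] (Fin 3 → K)} (hint : ∀ y ∈ M, ∀ y' ∈ M, Valued.v (pairing σ (Matrix.diagonal c) y y') ≤ 1)
    {T : GL (Fin 3) K} (hT : (T : Matrix (Fin 3) (Fin 3) K) = Matrix.diagonal ![α, β, 1]) (hTM : mapGL T M = M) {m mc : ℕ} (hmmc : m ≤ mc)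
    (hsq : LatticeInLevel ϖ mc (Matrix.diagonal ![(α - 1) * (α - 1), (β - 1) * (β - 1), 0]) M)
    {y₁ y₂ y₃ : Fin 3 → K} (hy₁ : y₁ ∈ M) (hy₂ : y₂ ∈ M) (hy₃0 : y₃ 0 = 0) (hy₃1 : y₃ 1 = 0)
    (hgen : ∀ y ∈ M, ∃ a b c' : K, Valued.v a ≤ 1 ∧ Valued.v b ≤ 1 ∧ ∀ i, y i = a * y₁ i + b * y₂ i + c' * y₃ i)
    (h12 : c 0 * σ (y₁ 0) * ((α - 1) * y₂ 0) + c 1 * σ (y₁ 1) * ((β - 1) * y₂ 1) = 0)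
    (hs₂ : Valued.v (c 0 * σ (y₂ 0) * ((α - 1) * y₂ 0) + c 1 * σ (y₂ 1) * ((β - 1) * y₂ 1)) ≤ Valued.v (ϖ ^ m)) :
    {v | ∃ y ∈ M, Valued.v ((ϖ ^ m)⁻¹ * (v - (c 0 * (α - 1) * (y 0 * σ (y 0)) + c 1 * (β - 1) * (y 1 * σ (y 1))))) ≤ 1} =
      valueSetMod σ ϖ m (((c 0 * σ (y₁ 0) * ((α - 1) * y₁ 0) + c 1 * σ (y₁ 1) * ((β - 1) * y₁ 1)) * ((ϖ - σ ϖ) * ((ϖ * σ ϖ) ^ ((d - d % 2) / 2))⁻¹)⁻¹) •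
        xPlus σ ϖ d) := by
  have hϖ0 : ϖ ≠ 0 := (Valuation.ne_zero_iff Valued.v).1 (by rw [hϖ]; exact exp_ne_zero)
  have hϖm : (ϖ ^ m : K) ≠ 0 := pow_ne_zero _ hϖ0
  set s₁ : K := c 0 * σ (y₁ 0) * ((α - 1) * y₁ 0) + c 1 * σ (y₁ 1) * ((β - 1) * y₁ 1) with hs₁def
  set s₂ : K := c 0 * σ (y₂ 0) * ((α - 1) * y₂ 0) + c 1 * σ (y₂ 1) * ((β - 1) * y₂ 1) with hs₂def
  set s₂₁ : K := c 0 * σ (y₂ 0) * ((α - 1) * y₁ 0) + c 1 * σ (y₂ 1) * ((β - 1) * y₁ 1) with hs₂₁def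
  set tp : K := (ϖ - σ ϖ) * ((ϖ * σ ϖ) ^ ((d - d % 2) / 2))⁻¹ with htpdef
  have h21 : Valued.v s₂₁ ≤ Valued.v (ϖ ^ mc) := by
    have h := v_cross_add_map_cross_le hσ hϖ0 hc₀ hc₁ hα hβ hint hT hTM hsq hy₁ hy₂
    rwa [h12, map_zero, add_zero] at h
  have hmcm : Valued.v (ϖ ^ mc) ≤ Valued.v (ϖ ^ m) := by
    rw [v_pow_eq_exp_neg hϖ, v_pow_eq_exp_neg hϖ, exp_le_exp]; omega
  have hN : ∀ a : K, Valued.v a ≤ 1 → Valued.v (a * σ a) ≤ 1 := fun a ha => by rw [map_mul, hvσ]; exact mul_le_one' ha ha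
  rw [valueSetMod_smul_xPlus]
  ext v
  simp only [Set.mem_setOf_eq]
  constructor
  · rintro ⟨y, hy, hv⟩
    obtain ⟨a, b, c', ha, hb, hyi⟩ := hgen y hy
    refine ⟨a, ha, ?_⟩
    have hval : c 0 * (α - 1) * (y 0 * σ (y 0)) + c 1 * (β - 1) * (y 1 * σ (y 1)) = a * σ a * s₁ + σ b * a * s₂₁ + b * σ b * s₂ := by
      rw [modelValue_eq_cross_self, cross_self_expand σ c α β hyi hy₃0 hy₃1, h12, mul_zero, add_zero]
    have key : (ϖ ^ m)⁻¹ * (v - s₁ * tp⁻¹ * (tp * (a * σ a))) =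
        (ϖ ^ m)⁻¹ * (v - (c 0 * (α - 1) * (y 0 * σ (y 0)) + c 1 * (β - 1) * (y 1 * σ (y 1)))) + σ b * a * ((ϖ ^ m)⁻¹ * s₂₁) + b * σ b * ((ϖ ^ m)⁻¹ * s₂) := by
      rw [hval]; field_simp; ring
    rw [key]
    refine (Valuation.map_add _ _ _).trans (max_le ((Valuation.map_add _ _ _).trans (max_le hv ?_)) ?_)
    · rw [map_mul, map_mul, hvσ]
      refine mul_le_one' (mul_le_one' hb ha) ?_
      rw [map_mul, map_inv₀]
      exact (mul_le_mul_right (h21.trans hmcm) _).trans (le_of_eq (inv_mul_cancel₀ ((Valuation.ne_zero_iff _).2 hϖm)))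
    · rw [map_mul]
      refine mul_le_one' (hN b hb) ?_
      rw [map_mul, map_inv₀]
      exact (mul_le_mul_right hs₂ _).trans (le_of_eq (inv_mul_cancel₀ ((Valuation.ne_zero_iff _).2 hϖm)))
  · rintro ⟨a, ha, hv⟩
    have haM : a • y₁ ∈ M := by
      have h := M.smul_mem (⟨a, (Valuation.mem_integer_iff _ _).2 ha⟩ : 𝒪[K]) hy₁
      exact h
    refine ⟨a • y₁, haM, ?_⟩
    have hval : c 0 * (α - 1) * ((a • y₁) 0 * σ ((a • y₁) 0)) + c 1 * (β - 1) * ((a • y₁) 1 * σ ((a • y₁) 1)) = s₁ * tp⁻¹ * (tp * (a * σ a)) := by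
      simp only [Pi.smul_apply, smul_eq_mul, map_mul]
      field_simp
      ring
    rw [hval]
    exact hv

/-- **A TOP VALUE ON THE CLEAN SHELL IS `ϖ^m`-CONGRUENT TO A `σ`-FIXED UNIT MULTIPLE OF `t₊`.**  Ramified datum clauses, `diag c` integral on `M`, `T`-stable, clean at `m_c`
with `1 ≤ d`, `d % 2 < m`, `m + d ≤ m_c + 1`; if `w ∈ M` has `|S(w, w)| = |ϖ|^{d % 2}` then `∃ e′` (`σe′ = e′`, `|e′| = 1`) with `|ϖ^{−m}((S(w,w)·t₊⁻¹ − e′)·t₊)| ≤ 1` — the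
hypothesis `hee` of ★ (L-lab-3) `labelPlus_smul_xPlus_iff_exists_norm_of_congr` (so the label of `(S(w,w)∕t₊) • X₊` is the norm class of `e′`).  (`Tr S(w,w) ∈ ϖ^{m_c}` by
★ p860136 §1, then ★ p859272 `exists_skew_near_of_trace_deep`.) [cite: Rogawski1990, §4.9 Prop. 4.9.1 (b) p. 55] [cite: Serre1979, Ch. III §3 Prop. 7] -/
theorem exists_fixed_unit_congr_of_clean {σ : K →+* K} {ϖ : K} {d t : ℕ} (hσ : ∀ x, σ (σ x) = x) (hvσ : ∀ a, Valued.v (σ a) = Valued.v a)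
    (hfix : ∀ x : K, σ x = x → x ≠ 0 → ∃ n : ℤ, Valued.v x = exp (2 * n))
    (hϖ : Valued.v ϖ = exp (-1 : ℤ)) (hd : Valued.v (ϖ - σ ϖ) = Valued.v ϖ ^ d) (ht : Valued.v (2 : K) = Valued.v ϖ ^ t)
    {c : Fin 3 → K} (hc₀ : σ (c 0) = c 0) (hc₁ : σ (c 1) = c 1) {α β : K} (hα : α * σ α = 1) (hβ : β * σ β = 1)
    {M : Submodule 𝒪[K] (Fin 3 → K)} (hint : ∀ y ∈ M, ∀ y' ∈ M, Valued.v (pairing σ (Matrix.diagonal c) y y') ≤ 1)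
    {T : GL (Fin 3) K} (hT : (T : Matrix (Fin 3) (Fin 3) K) = Matrix.diagonal ![α, β, 1]) (hTM : mapGL T M = M)
    {m mc : ℕ} (hm : d % 2 < m) (hmc : m + d ≤ mc + 1)
    (hsq : LatticeInLevel ϖ mc (Matrix.diagonal ![(α - 1) * (α - 1), (β - 1) * (β - 1), 0]) M)
    {w : Fin 3 → K} (hw : w ∈ M) (hsw : Valued.v (c 0 * σ (w 0) * ((α - 1) * w 0) + c 1 * σ (w 1) * ((β - 1) * w 1)) = Valued.v ϖ ^ (d % 2)) :
    ∃ e' : K, σ e' = e' ∧ Valued.v e' = 1 ∧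
      Valued.v ((ϖ ^ m)⁻¹ * (((c 0 * σ (w 0) * ((α - 1) * w 0) + c 1 * σ (w 1) * ((β - 1) * w 1)) * ((ϖ - σ ϖ) * ((ϖ * σ ϖ) ^ ((d - d % 2) / 2))⁻¹)⁻¹ - e') *
        ((ϖ - σ ϖ) * ((ϖ * σ ϖ) ^ ((d - d % 2) / 2))⁻¹))) ≤ 1 := by
  have hϖ0 : ϖ ≠ 0 := (Valuation.ne_zero_iff Valued.v).1 (by rw [hϖ]; exact exp_ne_zero)
  have hϖm : (ϖ ^ m : K) ≠ 0 := pow_ne_zero _ hϖ0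
  set s : K := c 0 * σ (w 0) * ((α - 1) * w 0) + c 1 * σ (w 1) * ((β - 1) * w 1) with hsdef
  have htr : Valued.v (s + σ s) ≤ Valued.v (ϖ ^ mc) := v_cross_add_map_cross_le hσ hϖ0 hc₀ hc₁ hα hβ hint hT hTM hsq hw hw
  obtain ⟨z', hσz', hzz'⟩ := exists_skew_near_of_trace_deep hσ hfix hϖ hd ht (a := s) (s := -(s + σ s)) (by rw [neg_neg])
    (j := (mc : ℤ)) (n := (((mc + 1) / 2 : ℕ) : ℤ)) (m := m) (by rw [Valuation.map_neg, ← v_pow_eq_exp_neg hϖ]; exact htr) (by omega) (by omega)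
  have hvs : Valued.v s = exp (-((d % 2 : ℕ) : ℤ)) := by rw [hsw, ← map_pow, v_pow_eq_exp_neg hϖ]
  have hlt : Valued.v (s - z') < Valued.v s := by
    have h1 : Valued.v (s - z') ≤ Valued.v (ϖ ^ m) := by
      have h := hzz'
      rw [map_mul, map_inv₀] at h
      rwa [inv_mul_le_iff₀ (zero_lt_iff.2 ((Valuation.ne_zero_iff _).2 hϖm)), mul_one] at h
    refine h1.trans_lt ?_
    rw [hvs, v_pow_eq_exp_neg hϖ, exp_lt_exp]
    omega
  have hvz' : Valued.v z' = exp (-((d % 2 : ℕ) : ℤ)) := by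
    rw [← hvs, show z' = s + -(s - z') by ring]
    exact Valuation.map_add_eq_of_lt_left _ (by rwa [Valuation.map_neg])
  have htp0 := refSkewScalar_ne_zero hvσ hϖ hd
  have htpv := v_refSkewScalar hvσ hϖ hd
  refine ⟨z' * ((ϖ - σ ϖ) * ((ϖ * σ ϖ) ^ ((d - d % 2) / 2))⁻¹)⁻¹, ?_, ?_, ?_⟩
  · rw [map_mul, map_inv₀, map_refSkewScalar_eq_neg hσ, hσz', inv_neg, neg_mul_neg]
  · rw [map_mul, map_inv₀, htpv, hvz', ← exp_neg, ← exp_add, ← exp_zero]; congr 1; ring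
  · rw [← sub_mul, inv_mul_cancel_right₀ htp0]
    exact hzz'

/-! ## §2  The clean-shell HNF vertex: which entry is on top, and the class read by name -/

/-- **TOP = `A`, OR (`b = 0`, TOP = `C`, `|D₀| = 1`)** on the clean shell of a normalised HNF vertex (★ (L-lab-19a), the Gram–Schmidt data dropped).
[cite: Kottwitz1986BaseChangeUnits, §1 pp. 240–241] [cite: Jacobowitz1962, §4, §7] -/
theorem top_A_or_top_C_of_clean_shell_latt_hnf {σ : K →+* K} {ϖ : K} {d t : ℕ} (hDat : IsRamifiedQuadraticDatum σ ϖ d t)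
    {D : Fin 3 → K} (hDσ : ∀ i, σ (D i) = D i) (hD0 : ∀ i, D i ≠ 0) {b c : ℕ} {x y z : K} (hx : Valued.v x ≤ 1) (hy : Valued.v y ≤ 1) (hz : Valued.v z ≤ 1)
    (hn : IsNormalisedLattice (latt (Matrix.of ![![1, 0, 0], ![x, ϖ ^ b, 0], ![y, z, ϖ ^ c]])))
    (hM : IsVertexLattice σ ϖ (Matrix.diagonal D) 0 (latt (Matrix.of ![![1, 0, 0], ![x, ϖ ^ b, 0], ![y, z, ϖ ^ c]])))
    {α β : K} {N₀ n₁ n₂ n₃ : ℕ} (hE : IsElementDatum σ ϖ N₀ α β n₁ n₂ n₃) {ℓ m mc : ℕ} (hℓN : ℓ + 1 ≤ N₀) (hmN : m ≤ N₀) (hℓmc : 2 * ℓ + 1 ≤ mc) (hmmc : m + ℓ ≤ mc)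
    (hlev : LatticeInLevel ϖ ℓ (Matrix.diagonal ![α - 1, β - 1, 0]) (latt (Matrix.of ![![1, 0, 0], ![x, ϖ ^ b, 0], ![y, z, ϖ ^ c]])))
    (hnlev : ¬ LatticeInLevel ϖ (ℓ + 1) (Matrix.diagonal ![α - 1, β - 1, 0]) (latt (Matrix.of ![![1, 0, 0], ![x, ϖ ^ b, 0], ![y, z, ϖ ^ c]])))
    (hsq : LatticeInLevel ϖ mc (Matrix.diagonal ![(α - 1) * (α - 1), (β - 1) * (β - 1), 0]) (latt (Matrix.of ![![1, 0, 0], ![x, ϖ ^ b, 0], ![y, z, ϖ ^ c]]))) :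
    Valued.v (D 0 * (α - 1) + D 1 * σ x * ((β - 1) * x)) = Valued.v (ϖ ^ ℓ) ∨
      (Valued.v (D 0 * (α - 1) + D 1 * σ x * ((β - 1) * x)) ≤ Valued.v (ϖ ^ (ℓ + 1)) ∧ b = 0 ∧
        Valued.v (D 1 * σ (ϖ ^ b) * ((β - 1) * ϖ ^ b)) = Valued.v (ϖ ^ ℓ) ∧ Valued.v (D 0) = 1) := by
  rcases explicit_top_of_clean_shell_latt_hnf hDat hDσ hD0 hx hy hz hn hM hE hℓN hmN hℓmc hmmc hlev hnlev hsq with ⟨hA, -⟩ | h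
  · exact Or.inl hA
  · exact Or.inr h

/-- **CLASS READ, CASE A (glued ∕ two-slot, or slot 0 dominating): `VAL_m(L) = valueSetMod σ ϖ m ((A∕t₊) • X₊)`** for `A = D₀(α−1) + D₁σx(β−1)x` on top (`|A| = |ϖ^ℓ|`), at a
clean-shell normalised HNF vertex stable under `T = diag(α, β, 1)` — ★ (L-lab-19a)'s explicit triple fed to §1. [cite: Rogawski1990, §4.9 Prop. 4.9.1 (b) p. 55]
[cite: Kottwitz1986BaseChangeUnits, §1 pp. 240–241] [cite: Jacobowitz1962, §4, §7] -/
theorem setOf_modelValue_latt_hnf_eq_smul_A {σ : K →+* K} {ϖ : K} {d t : ℕ} (hDat : IsRamifiedQuadraticDatum σ ϖ d t)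
    {D : Fin 3 → K} (hDσ : ∀ i, σ (D i) = D i) (hD0 : ∀ i, D i ≠ 0) {b c : ℕ} {x y z : K} (hx : Valued.v x ≤ 1) (hy : Valued.v y ≤ 1) (hz : Valued.v z ≤ 1)
    (hn : IsNormalisedLattice (latt (Matrix.of ![![1, 0, 0], ![x, ϖ ^ b, 0], ![y, z, ϖ ^ c]])))
    (hM : IsVertexLattice σ ϖ (Matrix.diagonal D) 0 (latt (Matrix.of ![![1, 0, 0], ![x, ϖ ^ b, 0], ![y, z, ϖ ^ c]])))
    {α β : K} {N₀ n₁ n₂ n₃ : ℕ} (hE : IsElementDatum σ ϖ N₀ α β n₁ n₂ n₃) {ℓ m mc : ℕ} (hℓN : ℓ + 1 ≤ N₀) (hmN : m ≤ N₀) (hℓmc : 2 * ℓ + 1 ≤ mc) (hmmc : m + ℓ ≤ mc)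
    (hlev : LatticeInLevel ϖ ℓ (Matrix.diagonal ![α - 1, β - 1, 0]) (latt (Matrix.of ![![1, 0, 0], ![x, ϖ ^ b, 0], ![y, z, ϖ ^ c]])))
    (hnlev : ¬ LatticeInLevel ϖ (ℓ + 1) (Matrix.diagonal ![α - 1, β - 1, 0]) (latt (Matrix.of ![![1, 0, 0], ![x, ϖ ^ b, 0], ![y, z, ϖ ^ c]])))
    (hsq : LatticeInLevel ϖ mc (Matrix.diagonal ![(α - 1) * (α - 1), (β - 1) * (β - 1), 0]) (latt (Matrix.of ![![1, 0, 0], ![x, ϖ ^ b, 0], ![y, z, ϖ ^ c]])))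
    {T : GL (Fin 3) K} (hT : (T : Matrix (Fin 3) (Fin 3) K) = Matrix.diagonal ![α, β, 1]) (hTM : mapGL T (latt (Matrix.of ![![1, 0, 0], ![x, ϖ ^ b, 0], ![y, z, ϖ ^ c]])) = latt (Matrix.of ![![1, 0, 0], ![x, ϖ ^ b, 0], ![y, z, ϖ ^ c]]))
    (hA : Valued.v (D 0 * (α - 1) + D 1 * σ x * ((β - 1) * x)) = Valued.v (ϖ ^ ℓ)) :
    {v | ∃ w ∈ latt (Matrix.of ![![1, 0, 0], ![x, ϖ ^ b, 0], ![y, z, ϖ ^ c]]), Valued.v ((ϖ ^ m)⁻¹ * (v - (D 0 * (α - 1) * (w 0 * σ (w 0)) + D 1 * (β - 1) * (w 1 * σ (w 1))))) ≤ 1} =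
      valueSetMod σ ϖ m (((D 0 * (α - 1) + D 1 * σ x * ((β - 1) * x)) * ((ϖ - σ ϖ) * ((ϖ * σ ϖ) ^ ((d - d % 2) / 2))⁻¹)⁻¹) • xPlus σ ϖ d) := by
  obtain ⟨hσ, hvσ, hϖ, hfix, hd, h1d, -⟩ := id hDat
  obtain ⟨hα, hβ, -⟩ := id hE
  have hϖ0 : ϖ ≠ 0 := (Valuation.ne_zero_iff Valued.v).1 (by rw [hϖ]; exact exp_ne_zero)
  -- the explicit triple (branch A; branch C contradicts `hA`)
  rcases explicit_top_of_clean_shell_latt_hnf hDat hDσ hD0 hx hy hz hn hM hE hℓN hmN hℓmc hmmc hlev hnlev hsq with ⟨-, κ, hκ, hκA, hy₂, hgen, hs₂⟩ | ⟨hAle, -⟩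
  · -- integrality of the form from self-duality
    have hdet : IsUnit (Matrix.diagonal D).det := by
      rw [Matrix.det_diagonal, isUnit_iff_ne_zero]; exact Finset.prod_ne_zero_iff.2 fun i _ => hD0 i
    have hdual := dualLatt_eq_self_of_isSelfDualLattice hvσ hdet hM
    have hint : ∀ w ∈ latt (Matrix.of ![![1, 0, 0], ![x, ϖ ^ b, 0], ![y, z, ϖ ^ c]]), ∀ w' ∈ latt (Matrix.of ![![1, 0, 0], ![x, ϖ ^ b, 0], ![y, z, ϖ ^ c]]), Valued.v (pairing σ (Matrix.diagonal D) w w') ≤ 1 := fun w hw w' hw' => by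
      have h := hw'; rw [← hdual, mem_dualLatt] at h; exact h w hw
    have hA0 : D 0 * (α - 1) + D 1 * σ x * ((β - 1) * x) ≠ 0 := fun h => by
      rw [h, map_zero] at hA; exact (Valuation.ne_zero_iff Valued.v).2 (pow_ne_zero ℓ hϖ0) hA.symm
    obtain ⟨h12, -⟩ := triple_A_values σ D α β x y z (ϖ ^ b) (ϖ ^ c) hA0 hκA
    obtain ⟨h00, h01, -⟩ := mulVec_hnf_apply x y z (ϖ ^ b) (ϖ ^ c) (1 : K) 0 0
    have hv0 : (Matrix.of ![![1, 0, 0], ![x, ϖ ^ b, 0], ![y, z, ϖ ^ c]]) *ᵥ ![1, 0, 0] ∈ latt (Matrix.of ![![1, 0, 0], ![x, ϖ ^ b, 0], ![y, z, ϖ ^ c]]) := mulVec_three_mem_latt _ (le_of_eq (map_one _)) (by rw [map_zero]; exact zero_le) (by rw [map_zero]; exact zero_le)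
    have h := setOf_modelValue_eq_valueSetMod_smul_of_triple hσ hvσ hϖ d (refSkewScalar_ne_zero hvσ hϖ hd) (hDσ 0) (hDσ 1) hα hβ hint hT hTM (by omega : m ≤ mc) hsq hv0 hy₂
      (y₃ := (Matrix.of ![![1, 0, 0], ![x, ϖ ^ b, 0], ![y, z, ϖ ^ c]]) *ᵥ ![0, 0, 1]) (by simp) (by simp) hgen h12 hs₂
    rw [h00, h01] at h
    simpa only [map_one, mul_one, mul_zero, add_zero] using h
  · exfalso
    have h := hA.symm.le.trans hAle
    rw [v_pow_eq_exp_neg hϖ, v_pow_eq_exp_neg hϖ, exp_le_exp] at h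
    omega

/-- **`|D₀| = 1` WHEN `b = 0` AND `C` IS ON TOP** (the strata core ∕ T₁; T₂ has `|D₁| = 1`, hence `|C| = |β − 1| ≠ |ϖ^ℓ|`; the glued strata have `b ≥ 1`).
[cite: Jacobowitz1962, §4, §7] [cite: Kottwitz1986BaseChangeUnits, §1 pp. 240–241] -/
theorem v_D0_eq_one_of_top_C {σ : K →+* K} {ϖ : K} {d t : ℕ} (hDat : IsRamifiedQuadraticDatum σ ϖ d t)
    {D : Fin 3 → K} (hDσ : ∀ i, σ (D i) = D i) (hD0 : ∀ i, D i ≠ 0) {c : ℕ} {x y z : K} (hx : Valued.v x ≤ 1) (hy : Valued.v y ≤ 1) (hz : Valued.v z ≤ 1)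
    (hn : IsNormalisedLattice (latt (Matrix.of ![![1, 0, 0], ![x, ϖ ^ 0, 0], ![y, z, ϖ ^ c]])))
    (hM : IsVertexLattice σ ϖ (Matrix.diagonal D) 0 (latt (Matrix.of ![![1, 0, 0], ![x, ϖ ^ 0, 0], ![y, z, ϖ ^ c]])))
    {β : K} {n₁ ℓ : ℕ} (hn₁v : Valued.v (β - 1) = Valued.v ϖ ^ n₁) (hℓ : ℓ + 1 ≤ n₁)
    (hC : Valued.v (D 1 * σ (ϖ ^ 0) * ((β - 1) * ϖ ^ 0)) = Valued.v (ϖ ^ ℓ)) : Valued.v (D 0) = 1 := by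
  obtain ⟨-, hvσ, hϖ, hfix, -, -, -⟩ := hDat
  have hq : ∀ n : ℕ, Valued.v (ϖ ^ n) = exp (-(n : ℤ)) := v_pow_eq_exp_neg hϖ
  have hw : Valued.v (β - 1) = exp (-(n₁ : ℤ)) := by rw [hn₁v, ← map_pow, hq]
  obtain ⟨-, ⟨hD1ge, -, hD1⟩, ⟨hD0ge, -, -, hD0v3⟩⟩ := dualFrame_values hvσ hϖ hD0 0 c hx hy hz hn hM
  rcases dualisable_strata hvσ hfix hϖ 0 c hx hy hz hn ⟨D, fun i => ⟨hDσ i, hD0 i⟩, hM⟩ with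
    ⟨-, hc0⟩ | ⟨s, hc0, hbs, -, hs2⟩ | ⟨s, -, hcs, -, hs2, hzs, hy1⟩ | ⟨s, -, hcs, -, -, hz1, hyxz⟩ |
    ⟨ρ, s, hρ, -, -, hbρ, -⟩ | ⟨ρ, s, hρ, -, -, hbρ, -⟩ | ⟨ρ, s, hρ, hs2, -, -, hbρs, -⟩ | ⟨ρ, hρ, hbρ, -⟩
  · -- core: `c = 0`
    subst hc0
    rcases hD0v3 with h | h | h
    · exact h
    · refine le_antisymm ?_ hD0ge
      rw [h]; simpa using hx
    · refine le_antisymm ?_ hD0ge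
      rw [h]
      have : Valued.v (x * z - y * ϖ ^ 0) ≤ 1 := by
        rw [pow_zero, mul_one]
        exact (Valuation.map_sub _ _ _).trans (max_le (by rw [map_mul]; exact mul_le_one' hx hz) hy)
      simpa using this
  · omega
  · -- T₂: `|D₁| = 1`, so `|C| = |β − 1| = exp(−n₁) ≠ exp(−ℓ)`
    exfalso
    rw [← hcs] at hzs
    have hD1one : Valued.v (D 1) = 1 := by
      rcases hD1 with h | h
      · simpa using h
      · refine le_antisymm ?_ (by simpa using hD1ge)
        rw [h]
        calc Valued.v z * exp (((0 : ℕ) : ℤ) + c) ≤ Valued.v (ϖ ^ c) * exp (((0 : ℕ) : ℤ) + c) := mul_le_mul_left hzs _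
          _ = 1 := by rw [hq, ← exp_add, ← exp_zero]; congr 1; push_cast; ring
    have h := hC
    simp only [pow_zero, map_mul, map_one, mul_one, hD1one, one_mul, hw, hq, exp_inj] at h
    omega
  · -- T₁: `|y − xz| ≤ |ϖ^c|`
    rw [← hcs] at hyxz
    rcases hD0v3 with h | h | h
    · exact h
    · refine le_antisymm ?_ hD0ge
      rw [h]; simpa using hx
    · refine le_antisymm ?_ hD0ge
      rw [h, show x * z - y * ϖ ^ 0 = -(y - x * z) by rw [pow_zero]; ring, Valuation.map_neg]
      calc Valued.v (y - x * z) * exp (((0 : ℕ) : ℤ) + c) ≤ Valued.v (ϖ ^ c) * exp (((0 : ℕ) : ℤ) + c) := mul_le_mul_left hyxz _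
        _ = 1 := by rw [hq, ← exp_add, ← exp_zero]; congr 1; push_cast; ring
  · omega
  · omega
  · omega
  · omega

/-- **CLASS READ, CASE C (`b = 0`, slot 1 on top): `VAL_m(L) = valueSetMod σ ϖ m ((C∕t₊) • X₊)`**, `C = D₁σ(ϖ^b)(β−1)ϖ^b` (`= D₁(β−1)` at `b = 0`), at a clean-shell normalised HNF vertex
stable under `T = diag(α, β, 1)` — the triple `(Ve₁, V(1,−x,0), Ve₂)`, second value `D₀(α−1)` with `|D₀| = 1`. [cite: Rogawski1990, §4.9 Prop. 4.9.1 (b) p. 55]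
[cite: Kottwitz1986BaseChangeUnits, §1 pp. 240–241] [cite: Jacobowitz1962, §4, §7] -/
theorem setOf_modelValue_latt_hnf_eq_smul_C {σ : K →+* K} {ϖ : K} {d t : ℕ} (hDat : IsRamifiedQuadraticDatum σ ϖ d t)
    {D : Fin 3 → K} (hDσ : ∀ i, σ (D i) = D i) (hD0 : ∀ i, D i ≠ 0) {b c : ℕ} {x y z : K} (hx : Valued.v x ≤ 1) (hy : Valued.v y ≤ 1) (hz : Valued.v z ≤ 1)
    (hn : IsNormalisedLattice (latt (Matrix.of ![![1, 0, 0], ![x, ϖ ^ b, 0], ![y, z, ϖ ^ c]])))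
    (hM : IsVertexLattice σ ϖ (Matrix.diagonal D) 0 (latt (Matrix.of ![![1, 0, 0], ![x, ϖ ^ b, 0], ![y, z, ϖ ^ c]])))
    {α β : K} {N₀ n₁ n₂ n₃ : ℕ} (hE : IsElementDatum σ ϖ N₀ α β n₁ n₂ n₃) {ℓ m mc : ℕ} (hℓN : ℓ + 1 ≤ N₀) (hmN : m ≤ N₀) (hmmc : m + ℓ ≤ mc)
    (hlev : LatticeInLevel ϖ ℓ (Matrix.diagonal ![α - 1, β - 1, 0]) (latt (Matrix.of ![![1, 0, 0], ![x, ϖ ^ b, 0], ![y, z, ϖ ^ c]])))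
    (hnlev : ¬ LatticeInLevel ϖ (ℓ + 1) (Matrix.diagonal ![α - 1, β - 1, 0]) (latt (Matrix.of ![![1, 0, 0], ![x, ϖ ^ b, 0], ![y, z, ϖ ^ c]])))
    (hsq : LatticeInLevel ϖ mc (Matrix.diagonal ![(α - 1) * (α - 1), (β - 1) * (β - 1), 0]) (latt (Matrix.of ![![1, 0, 0], ![x, ϖ ^ b, 0], ![y, z, ϖ ^ c]])))
    {T : GL (Fin 3) K} (hT : (T : Matrix (Fin 3) (Fin 3) K) = Matrix.diagonal ![α, β, 1]) (hTM : mapGL T (latt (Matrix.of ![![1, 0, 0], ![x, ϖ ^ b, 0], ![y, z, ϖ ^ c]])) = latt (Matrix.of ![![1, 0, 0], ![x, ϖ ^ b, 0], ![y, z, ϖ ^ c]]))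
    (hb : b = 0) (hC : Valued.v (D 1 * σ (ϖ ^ b) * ((β - 1) * ϖ ^ b)) = Valued.v (ϖ ^ ℓ)) :
    {v | ∃ w ∈ latt (Matrix.of ![![1, 0, 0], ![x, ϖ ^ b, 0], ![y, z, ϖ ^ c]]), Valued.v ((ϖ ^ m)⁻¹ * (v - (D 0 * (α - 1) * (w 0 * σ (w 0)) + D 1 * (β - 1) * (w 1 * σ (w 1))))) ≤ 1} =
      valueSetMod σ ϖ m (((D 1 * σ (ϖ ^ b) * ((β - 1) * ϖ ^ b)) * ((ϖ - σ ϖ) * ((ϖ * σ ϖ) ^ ((d - d % 2) / 2))⁻¹)⁻¹) • xPlus σ ϖ d) := by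
  obtain ⟨hσ, hvσ, hϖ, hfix, hd, h1d, -⟩ := id hDat
  obtain ⟨hα, hβ, -, -, -, hn₁v, hn₂v, -, hN₁, hN₂, -⟩ := id hE
  have hϖ0 : ϖ ≠ 0 := (Valuation.ne_zero_iff Valued.v).1 (by rw [hϖ]; exact exp_ne_zero)
  subst hb
  have hD0one := v_D0_eq_one_of_top_C hDat hDσ hD0 hx hy hz hn hM hn₁v (by omega) hC
  -- integrality of the form from self-duality
  have hdet : IsUnit (Matrix.diagonal D).det := by
    rw [Matrix.det_diagonal, isUnit_iff_ne_zero]; exact Finset.prod_ne_zero_iff.2 fun i _ => hD0 i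
  have hdual := dualLatt_eq_self_of_isSelfDualLattice hvσ hdet hM
  -- pass to the literal `1` in place of `ϖ^0`
  simp only [pow_zero] at hn hM hlev hnlev hsq hTM hdual hC ⊢
  have hint : ∀ w ∈ latt (Matrix.of ![![1, 0, 0], ![x, 1, 0], ![y, z, ϖ ^ c]]), ∀ w' ∈ latt (Matrix.of ![![1, 0, 0], ![x, 1, 0], ![y, z, ϖ ^ c]]),
      Valued.v (pairing σ (Matrix.diagonal D) w w') ≤ 1 := fun w hw w' hw' => by
    have h := hw'; rw [← hdual, mem_dualLatt] at h; exact h w hw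
  obtain ⟨h12, h22⟩ := triple_C_values σ D α β x y z (ϖ ^ c)
  obtain ⟨g10, g11, -⟩ := mulVec_hnf_apply x y z (1 : K) (ϖ ^ c) (0 : K) 1 0
  have hv1 : (Matrix.of ![![1, 0, 0], ![x, 1, 0], ![y, z, ϖ ^ c]]) *ᵥ ![0, 1, 0] ∈ latt (Matrix.of ![![1, 0, 0], ![x, 1, 0], ![y, z, ϖ ^ c]]) :=
    mulVec_three_mem_latt _ (by rw [map_zero]; exact zero_le) (le_of_eq (map_one _)) (by rw [map_zero]; exact zero_le)
  have hy₂ : (Matrix.of ![![1, 0, 0], ![x, 1, 0], ![y, z, ϖ ^ c]]) *ᵥ ![1, -x, 0] ∈ latt (Matrix.of ![![1, 0, 0], ![x, 1, 0], ![y, z, ϖ ^ c]]) :=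
    mulVec_three_mem_latt _ (le_of_eq (map_one _)) (by rw [Valuation.map_neg]; exact hx) (by rw [map_zero]; exact zero_le)
  have hs₂ : Valued.v (D 0 * σ (((Matrix.of ![![1, 0, 0], ![x, 1, 0], ![y, z, ϖ ^ c]]) *ᵥ ![1, -x, 0]) 0) *
        ((α - 1) * ((Matrix.of ![![1, 0, 0], ![x, 1, 0], ![y, z, ϖ ^ c]]) *ᵥ ![1, -x, 0]) 0) +
      D 1 * σ (((Matrix.of ![![1, 0, 0], ![x, 1, 0], ![y, z, ϖ ^ c]]) *ᵥ ![1, -x, 0]) 1) *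
        ((β - 1) * ((Matrix.of ![![1, 0, 0], ![x, 1, 0], ![y, z, ϖ ^ c]]) *ᵥ ![1, -x, 0]) 1)) ≤ Valued.v (ϖ ^ m) := by
    rw [h22, map_mul, hD0one, one_mul, hn₂v, ← map_pow, v_pow_eq_exp_neg hϖ, v_pow_eq_exp_neg hϖ, exp_le_exp]
    omega
  have h := setOf_modelValue_eq_valueSetMod_smul_of_triple hσ hvσ hϖ d (refSkewScalar_ne_zero hvσ hϖ hd) (hDσ 0) (hDσ 1) hα hβ hint hT hTM (by omega : m ≤ mc) hsq hv1 hy₂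
    (y₃ := (Matrix.of ![![1, 0, 0], ![x, 1, 0], ![y, z, ϖ ^ c]]) *ᵥ ![0, 0, 1]) (by simp) (by simp) (fun w hw => exists_coords_shear₁ _ hx hw) h12 hs₂
  rw [g10, g11] at h
  simpa only [map_zero, map_one, mul_one, mul_zero, zero_mul, zero_add, add_zero, one_mul] using h

/-- **DOMINATED READ, SLOT 0: `VAL_m(L) = valueSetMod σ ϖ m ((D₀(α−1)∕t₊) • X₊)`** when `A` is on top and the slot-1 term `D₁σx(β−1)x` of `A` lies in `ϖ^m`
(★ `valueSetMod_smul_xPlus_congr` on case A). [cite: Rogawski1990, §4.9 Prop. 4.9.1 (b) p. 55] [cite: Kottwitz1986BaseChangeUnits, §1 pp. 240–241] -/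
theorem setOf_modelValue_latt_hnf_eq_smul_slot0 {σ : K →+* K} {ϖ : K} {d t : ℕ} (hDat : IsRamifiedQuadraticDatum σ ϖ d t)
    {D : Fin 3 → K} (hDσ : ∀ i, σ (D i) = D i) (hD0 : ∀ i, D i ≠ 0) {b c : ℕ} {x y z : K} (hx : Valued.v x ≤ 1) (hy : Valued.v y ≤ 1) (hz : Valued.v z ≤ 1)
    (hn : IsNormalisedLattice (latt (Matrix.of ![![1, 0, 0], ![x, ϖ ^ b, 0], ![y, z, ϖ ^ c]])))
    (hM : IsVertexLattice σ ϖ (Matrix.diagonal D) 0 (latt (Matrix.of ![![1, 0, 0], ![x, ϖ ^ b, 0], ![y, z, ϖ ^ c]])))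
    {α β : K} {N₀ n₁ n₂ n₃ : ℕ} (hE : IsElementDatum σ ϖ N₀ α β n₁ n₂ n₃) {ℓ m mc : ℕ} (hℓN : ℓ + 1 ≤ N₀) (hmN : m ≤ N₀) (hℓmc : 2 * ℓ + 1 ≤ mc) (hmmc : m + ℓ ≤ mc)
    (hlev : LatticeInLevel ϖ ℓ (Matrix.diagonal ![α - 1, β - 1, 0]) (latt (Matrix.of ![![1, 0, 0], ![x, ϖ ^ b, 0], ![y, z, ϖ ^ c]])))
    (hnlev : ¬ LatticeInLevel ϖ (ℓ + 1) (Matrix.diagonal ![α - 1, β - 1, 0]) (latt (Matrix.of ![![1, 0, 0], ![x, ϖ ^ b, 0], ![y, z, ϖ ^ c]])))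
    (hsq : LatticeInLevel ϖ mc (Matrix.diagonal ![(α - 1) * (α - 1), (β - 1) * (β - 1), 0]) (latt (Matrix.of ![![1, 0, 0], ![x, ϖ ^ b, 0], ![y, z, ϖ ^ c]])))
    {T : GL (Fin 3) K} (hT : (T : Matrix (Fin 3) (Fin 3) K) = Matrix.diagonal ![α, β, 1]) (hTM : mapGL T (latt (Matrix.of ![![1, 0, 0], ![x, ϖ ^ b, 0], ![y, z, ϖ ^ c]])) = latt (Matrix.of ![![1, 0, 0], ![x, ϖ ^ b, 0], ![y, z, ϖ ^ c]]))
    (hA : Valued.v (D 0 * (α - 1) + D 1 * σ x * ((β - 1) * x)) = Valued.v (ϖ ^ ℓ))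
    (hdom : Valued.v ((ϖ ^ m)⁻¹ * (D 1 * σ x * ((β - 1) * x))) ≤ 1) :
    {v | ∃ w ∈ latt (Matrix.of ![![1, 0, 0], ![x, ϖ ^ b, 0], ![y, z, ϖ ^ c]]), Valued.v ((ϖ ^ m)⁻¹ * (v - (D 0 * (α - 1) * (w 0 * σ (w 0)) + D 1 * (β - 1) * (w 1 * σ (w 1))))) ≤ 1} = valueSetMod σ ϖ m ((D 0 * (α - 1) * ((ϖ - σ ϖ) * ((ϖ * σ ϖ) ^ ((d - d % 2) / 2))⁻¹)⁻¹) • xPlus σ ϖ d) := by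
  obtain ⟨-, hvσ, hϖ, -, hd, -, -⟩ := id hDat
  have htp0 := refSkewScalar_ne_zero hvσ hϖ hd
  rw [setOf_modelValue_latt_hnf_eq_smul_A hDat hDσ hD0 hx hy hz hn hM hE hℓN hmN hℓmc hmmc hlev hnlev hsq hT hTM hA]
  refine valueSetMod_smul_xPlus_congr hvσ ϖ d m ?_
  rw [← sub_mul, inv_mul_cancel_right₀ htp0, add_sub_cancel_left]
  exact hdom

/-- **DOMINATED READ, SLOT 1: `VAL_m(L) = valueSetMod σ ϖ m ((D₁σx(β−1)x∕t₊) • X₊)`** when `A` is on top and the slot-0 term `D₀(α−1)` of `A` lies in `ϖ^m`.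
[cite: Rogawski1990, §4.9 Prop. 4.9.1 (b) p. 55] [cite: Kottwitz1986BaseChangeUnits, §1 pp. 240–241] -/
theorem setOf_modelValue_latt_hnf_eq_smul_slot1 {σ : K →+* K} {ϖ : K} {d t : ℕ} (hDat : IsRamifiedQuadraticDatum σ ϖ d t)
    {D : Fin 3 → K} (hDσ : ∀ i, σ (D i) = D i) (hD0 : ∀ i, D i ≠ 0) {b c : ℕ} {x y z : K} (hx : Valued.v x ≤ 1) (hy : Valued.v y ≤ 1) (hz : Valued.v z ≤ 1)
    (hn : IsNormalisedLattice (latt (Matrix.of ![![1, 0, 0], ![x, ϖ ^ b, 0], ![y, z, ϖ ^ c]])))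
    (hM : IsVertexLattice σ ϖ (Matrix.diagonal D) 0 (latt (Matrix.of ![![1, 0, 0], ![x, ϖ ^ b, 0], ![y, z, ϖ ^ c]])))
    {α β : K} {N₀ n₁ n₂ n₃ : ℕ} (hE : IsElementDatum σ ϖ N₀ α β n₁ n₂ n₃) {ℓ m mc : ℕ} (hℓN : ℓ + 1 ≤ N₀) (hmN : m ≤ N₀) (hℓmc : 2 * ℓ + 1 ≤ mc) (hmmc : m + ℓ ≤ mc)
    (hlev : LatticeInLevel ϖ ℓ (Matrix.diagonal ![α - 1, β - 1, 0]) (latt (Matrix.of ![![1, 0, 0], ![x, ϖ ^ b, 0], ![y, z, ϖ ^ c]])))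
    (hnlev : ¬ LatticeInLevel ϖ (ℓ + 1) (Matrix.diagonal ![α - 1, β - 1, 0]) (latt (Matrix.of ![![1, 0, 0], ![x, ϖ ^ b, 0], ![y, z, ϖ ^ c]])))
    (hsq : LatticeInLevel ϖ mc (Matrix.diagonal ![(α - 1) * (α - 1), (β - 1) * (β - 1), 0]) (latt (Matrix.of ![![1, 0, 0], ![x, ϖ ^ b, 0], ![y, z, ϖ ^ c]])))
    {T : GL (Fin 3) K} (hT : (T : Matrix (Fin 3) (Fin 3) K) = Matrix.diagonal ![α, β, 1]) (hTM : mapGL T (latt (Matrix.of ![![1, 0, 0], ![x, ϖ ^ b, 0], ![y, z, ϖ ^ c]])) = latt (Matrix.of ![![1, 0, 0], ![x, ϖ ^ b, 0], ![y, z, ϖ ^ c]]))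
    (hA : Valued.v (D 0 * (α - 1) + D 1 * σ x * ((β - 1) * x)) = Valued.v (ϖ ^ ℓ))
    (hdom : Valued.v ((ϖ ^ m)⁻¹ * (D 0 * (α - 1))) ≤ 1) :
    {v | ∃ w ∈ latt (Matrix.of ![![1, 0, 0], ![x, ϖ ^ b, 0], ![y, z, ϖ ^ c]]), Valued.v ((ϖ ^ m)⁻¹ * (v - (D 0 * (α - 1) * (w 0 * σ (w 0)) + D 1 * (β - 1) * (w 1 * σ (w 1))))) ≤ 1} = valueSetMod σ ϖ m ((D 1 * σ x * ((β - 1) * x) * ((ϖ - σ ϖ) * ((ϖ * σ ϖ) ^ ((d - d % 2) / 2))⁻¹)⁻¹) • xPlus σ ϖ d) := by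
  obtain ⟨-, hvσ, hϖ, -, hd, -, -⟩ := id hDat
  have htp0 := refSkewScalar_ne_zero hvσ hϖ hd
  rw [setOf_modelValue_latt_hnf_eq_smul_A hDat hDσ hD0 hx hy hz hn hM hE hℓN hmN hℓmc hmmc hlev hnlev hsq hT hTM hA]
  refine valueSetMod_smul_xPlus_congr hvσ ϖ d m ?_
  rw [← sub_mul, inv_mul_cancel_right₀ htp0, add_sub_cancel_right]
  exact hdom


end Summit.HodgeConjecture.HodgeConjecture.Cruxes.H413.F0P3cDyRamLabelClassOfStratum

end
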